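import Mathlib.Tactic.IntervalCases
import Mathlib.Tactic.Push
import Literature.Computability.MetaComplexity.TseitinLift
import HarnessLib

/-!
# Proofs: critical supports of Res(⊕) lines on the lifted Tseitin contradiction `τ(G, c) ∘ MAJ₃`

Sibling proof file of `TseitinLift.lean` (objects `tseitinMaj`, `critAt`, `critSupport`). It proves the standard
bookkeeping of the critical-assignment ("bottleneck counting") method, transcribed from resolution clauses and
`Pigeon(C)` (Jukna 2012 §18.4, §18.7; Urquhart 1987 §4; Ben-Sasson–Wigderson 2001) to LINEAR clauses and the two
rules of dag-like Res(⊕) with semantic weakening (Itsykson–Sokolov 2020 §2):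

* `LinClause.eval_eq_false_iff` — a linear clause is false iff all its literals are;
* `critSupport_mono`, `critSupport_weaken`, `critSupport_resolve` — the critical support is monotone under semantic
  consequence and subadditive under the resolution rule `C ∨ (f = 0), D ∨ (f = 1) ⊢ C ∨ D`;
* `critSupport_empty_eq_univ` — the empty clause has full support once every vertex has a critical assignment;
* `vertexOK_congr` — the lifted parity constraint of `u` reads only the star variables `liftVars G u`;
* `critSupport_toLinClause_subset_singleton`, `card_critSupport_toLinClause_le_one` — axioms have support `≤ 1`;
* `exists_medium_critSupport_of_isResLinRefutation` — **every Res(⊕) refutation of `τ(G, c) ∘ MAJ₃` has a line of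
  medium critical support** (`⌈N/8⌉ < |S| < N - ⌈N/8⌉`, for `N ≥ 24`), the Res(⊕) form of the intermediate clause of
  the Ben-Sasson–Wigderson / Urquhart argument.

## Source and printed argument

S. Jukna, *Boolean Function Complexity* (Springer 2012), §18.7, proof of Thm 18.17 (Tseitin formulas on
expanders): with `μ(C)` = the number of vertices `v` such that some `v`-critical assignment falsifies `C`, axioms
have `μ ≤ 1`, the empty clause has `μ = |V|`, `μ` is subadditive along the refutation, hence some clause has
`|V|/3 < μ(C) ≤ 2|V|/3`. A. Urquhart, *Hard examples for resolution*, J. ACM 34 (1987) §4 (the original).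
D. Itsykson, D. Sokolov, *Resolution over linear equations modulo two*, Ann. Pure Appl. Logic 171 (2020) §2
(linear clauses; the resolution and semantic weakening rules). The transcription to linear clauses is verbatim:
only soundness of the two rules is used.
-/

namespace Literature.Computability.MetaComplexity

open _root_.Computability Complexity Finset

section TseitinLiftProofs

variable {N : ℕ} (G : SimpleGraph (Fin N)) [DecidableRel G.Adj] (c : Fin N → Bool)

/-- A linear clause is false under `σ` iff all its linear literals are false under `σ`. [folklore]
[cite: ItsyksonSokolov2020, §2 (semantics of linear clauses)] -/
theorem LinClause.eval_eq_false_iff (σ : ℕ → Bool) (C : LinClause) :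
    C.eval σ = false ↔ ∀ l ∈ C, l.eval σ = false := by
  unfold LinClause.eval
  simp only [decide_eq_false_iff_not, not_exists, not_and, Bool.not_eq_true]

/-- Monotonicity of the critical support: if every falsifier of `D` falsifies `C`, then
`critSupport D ⊆ critSupport C` (as for `Pigeon(C)`). [Jukna 2012, §18.4 (proof of Claim 18.6: the weight
`μ` under semantic consequence)] [cite: Jukna2012, §18.4] -/
theorem critSupport_mono {C D : LinClause}
    (h : ∀ σ : ℕ → Bool, D.eval σ = false → C.eval σ = false) :
    critSupport G c D ⊆ critSupport G c C := by
  intro u hu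
  rw [mem_critSupport] at hu ⊢
  obtain ⟨x, hx, hD⟩ := hu
  exact ⟨x, hx, h _ hD⟩

/-- The semantic WEAKENING rule of Res(⊕) can only shrink the critical support. [Itsykson–Sokolov 2020, §2
(the weakening rule); Jukna 2012, §18.4] [cite: ItsyksonSokolov2020, §2] -/
theorem critSupport_weaken {C D : LinClause}
    (h : ∀ σ : ℕ → Bool, D.eval σ = true → C.eval σ = true) :
    critSupport G c C ⊆ critSupport G c D := by
  refine critSupport_mono G c fun σ hC => ?_
  cases hD : D.eval σ
  · rfl
  · rw [h σ hD] at hC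
    exact absurd hC (by simp)

/-- SUBADDITIVITY under the Res(⊕) resolution rule: the critical support of the resolvent `C ∪ D` of
`C ∨ (f = 0)` and `D ∨ (f = 1)` lies in the union of the critical supports of the premises (every falsifier of
the resolvent falsifies the premise whose side literal disagrees with the parity of `f`). [Itsykson–Sokolov 2020,
§2 (soundness of the resolution rule); Jukna 2012, §18.4 (`μ(C) ≤ μ(C₁) + μ(C₂)`)] [cite: Jukna2012, §18.4] -/
theorem critSupport_resolve (f : Finset ℕ) (C D : LinClause) :
    critSupport G c (C ∪ D) ⊆
      critSupport G c (insert (f, false) C) ∪ critSupport G c (insert (f, true) D) := by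
  intro u hu
  rw [mem_critSupport] at hu
  obtain ⟨x, hx, hCD⟩ := hu
  rw [LinClause.eval_eq_false_iff] at hCD
  rw [Finset.mem_union, mem_critSupport, mem_critSupport]
  -- the parity of `f` under `pad x` decides which premise is falsified
  by_cases hp : ((f.filter fun i => pad x i = true).card % 2) = 0
  · -- `f = 1` is false, so `insert (f, true) D` is falsified
    right
    refine ⟨x, hx, ?_⟩
    rw [LinClause.eval_eq_false_iff]
    intro l hl
    rw [Finset.mem_insert] at hl
    rcases hl with rfl | hl
    · simp [LinLit.eval, hp]
    · exact hCD l (Finset.mem_union_right _ hl)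
  · left
    refine ⟨x, hx, ?_⟩
    rw [LinClause.eval_eq_false_iff]
    intro l hl
    rw [Finset.mem_insert] at hl
    rcases hl with rfl | hl
    · simp [LinLit.eval, hp]
    · exact hCD l (Finset.mem_union_left _ hl)

/-- If every vertex has a critical assignment, the EMPTY linear clause has full critical support.
[Jukna 2012, §18.7 (proof of Thm 18.17: `μ(∅) = |V|` needs a `v`-critical assignment for every `v`)]
[cite: Jukna2012, Thm 18.17] -/
theorem critSupport_empty_eq_univ (hne : ∀ u, (critAt G c u).Nonempty) :
    critSupport G c (∅ : LinClause) = Finset.univ := by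
  ext u
  simp only [Finset.mem_univ, iff_true, mem_critSupport]
  obtain ⟨x, hx⟩ := hne u
  exact ⟨x, hx, by simp [LinClause.eval]⟩

/-- LOCALITY of the lifted parity constraint: `vertexOK G c σ u` depends only on the values of `σ` on the star
variables `liftVars G u`. [Bhattacharya–Byramji–Chattopadhyay–Impagliazzo 2026, §5 (the constraint of `v` reads
only the lifted variables of the edges at `v`)] [cite: BhattacharyaEtAl2026, Thm 1.2] -/
theorem vertexOK_congr {σ σ' : ℕ → Bool} (u : Fin N)
    (h : ∀ i ∈ liftVars G u, σ i = σ' i) : vertexOK G c σ u = vertexOK G c σ' u := by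
  have hmem : ∀ w, G.Adj u w → ∀ i, i < 3 → liftVar s(u, w) i ∈ liftVars G u := by
    intro w hw i hi
    unfold liftVars
    rw [List.mem_flatMap]
    refine ⟨w, ?_, ?_⟩
    · unfold tseitinNeighbors
      simp [hw]
    · interval_cases i <;> simp
  have hedge : ∀ w ∈ G.neighborFinset u, edgeVal σ s(u, w) = edgeVal σ' s(u, w) := by
    intro w hw
    rw [SimpleGraph.mem_neighborFinset] at hw
    unfold edgeVal
    rw [h _ (hmem w hw 0 (by norm_num)), h _ (hmem w hw 1 (by norm_num)),
      h _ (hmem w hw 2 (by norm_num))]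
  unfold vertexOK
  rw [Finset.filter_congr (fun w hw => by rw [hedge w hw])]

/-- An INITIAL clause of `τ(G, c) ∘ MAJ₃` at vertex `u` is falsified only by assignments violating the parity
constraint of `u`; hence its critical support is `⊆ {u}`. [Jukna 2012, §18.7 (proof of Thm 18.17: an axiom of
vertex `v` has `μ = 1`); Urquhart 1987, §4] [cite: Jukna2012, Thm 18.17] -/
theorem critSupport_toLinClause_subset_singleton (u : Fin N) (cl : Clause ℕ)
    (hcl : cl ∈ tseitinMajVertexClauses G c u) :
    critSupport G c (Clause.toLinClause cl) ⊆ {u} := by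
  intro v hv
  rw [Finset.mem_singleton]
  rw [mem_critSupport] at hv
  obtain ⟨x, hx, hfalse⟩ := hv
  -- unpack the clause: `cl = (liftVars G u).map (i ↦ (i, ¬(i ∈ T)))` with `T` violating `u`
  unfold tseitinMajVertexClauses at hcl
  rw [List.mem_map] at hcl
  obtain ⟨T, hT, rfl⟩ := hcl
  rw [List.mem_filter] at hT
  obtain ⟨-, hviol⟩ := hT
  -- `pad x` agrees with `T` on the star of `u`
  have hagree : ∀ i ∈ liftVars G u, pad x i = decide (i ∈ T) := by
    intro i hi
    rw [eval_toLinClause] at hfalse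
    have hlit : Literal.eval (pad x) (i, decide (i ∉ T)) = false := by
      have := List.any_eq_false.mp hfalse (i, decide (i ∉ T)) (List.mem_map.mpr ⟨i, hi, rfl⟩)
      simpa using this
    unfold Literal.eval at hlit
    revert hlit
    cases pad x i <;> by_cases hiT : i ∈ T <;> simp [hiT]
  have hu : vertexOK G c (pad x) u = false := by
    rw [vertexOK_congr G c u hagree]
    simpa using hviol
  -- `x` is `v`-critical: the constraint of `u` fails only if `u = v`
  rw [mem_critAt] at hx
  by_contra huv
  have := (hx u).mpr (fun h => huv h.symm)
  rw [hu] at this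
  exact Bool.false_ne_true this

/-- Initial clauses of `τ(G, c) ∘ MAJ₃` have critical support of size `≤ 1`. [Jukna 2012, §18.7 (proof of
Thm 18.17)] [cite: Jukna2012, Thm 18.17] -/
theorem card_critSupport_toLinClause_le_one (cl : Clause ℕ) (hcl : cl ∈ tseitinMaj G c) :
    (critSupport G c (Clause.toLinClause cl)).card ≤ 1 := by
  unfold tseitinMaj at hcl
  rw [List.mem_flatMap] at hcl
  obtain ⟨u, -, hu⟩ := hcl
  calc (critSupport G c (Clause.toLinClause cl)).card ≤ ({u} : Finset (Fin N)).card :=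
        Finset.card_le_card (critSupport_toLinClause_subset_singleton G c u cl hu)
    _ = 1 := Finset.card_singleton u

/-- **Every Res(⊕) refutation of `τ(G, c) ∘ MAJ₃` has a line of MEDIUM critical support** — the dag-like
Res(⊕) / critical-support form of the Ben-Sasson–Wigderson–Urquhart "intermediate clause": if `N ≥ 24` and every
vertex has a critical assignment, then every Res(⊕) refutation `π` (dag-like, with semantic weakening) contains a
line `l` with `⌈N/8⌉ < |critSupport (l.clause)| < N - ⌈N/8⌉` (indeed `N/3 < |critSupport| ≤ 2N/3`: the first line in
derivation order whose support exceeds `N/3`; axioms have support `≤ 1`, the empty clause has support `N`, and the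
support is subadditive / monotone under the two rules). [Jukna 2012, Thm 18.17 (proof: the clause `C` with
`|V|/3 < μ(C) ≤ 2|V|/3`); Urquhart 1987, §4; Itsykson–Sokolov 2020, §2 (the rules of Res(⊕))]
[cite: Jukna2012, Thm 18.17] -/
theorem exists_medium_critSupport_of_isResLinRefutation :
    ∀ (N : ℕ), 24 ≤ N → ∀ (G : SimpleGraph (Fin N)) [DecidableRel G.Adj] (c : Fin N → Bool),
      (∀ u, (critAt G c u).Nonempty) →
      ∀ π : List ResLinLine, IsResLinRefutation (tseitinMaj G c) π →
        ∃ l ∈ π, (N + 7) / 8 < (critSupport G c l.clause).card ∧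
          (critSupport G c l.clause).card + (N + 7) / 8 < N := by
  intro N hN G _ c hne π hπ
  classical
  obtain ⟨hder, l₀, hl₀, hempty⟩ := hπ
  -- measure of line k
  let μ : ℕ → ℕ := fun k => if hk : k < π.length then (critSupport G c (π[k]'hk).clause).card else 0
  have hμ : ∀ k (hk : k < π.length), μ k = (critSupport G c (π[k]'hk).clause).card := by
    intro k hk
    simp [μ, hk]
  -- the empty clause is a big line
  obtain ⟨k₀, hk₀, rfl⟩ := List.mem_iff_getElem.mp hl₀
  have hex : ∃ k, k < π.length ∧ N < 3 * μ k := by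
    refine ⟨k₀, hk₀, ?_⟩
    rw [hμ k₀ hk₀, hempty, critSupport_empty_eq_univ G c hne, Finset.card_univ, Fintype.card_fin]
    omega
  -- the first big line
  let k := Nat.find hex
  have hk : k < π.length ∧ N < 3 * μ k := Nat.find_spec hex
  have hmin : ∀ i, i < k → i < π.length → 3 * μ i ≤ N := by
    intro i hi hil
    have := Nat.find_min hex hi
    push Not at this
    exact this hil
  refine ⟨π[k]'hk.1, List.getElem_mem _, ?_⟩
  -- it suffices that the first big line is not too big
  suffices hup : 3 * μ k ≤ 2 * N by
    have h1 := hk.2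
    rw [hμ k hk.1] at h1 hup
    constructor <;> omega
  -- case analysis on the rule of line k
  have hvalid := hder k hk.1
  unfold IsValidResLinLine at hvalid
  split at hvalid
  · -- initial: support ≤ 1, contradicting bigness
    obtain ⟨cl, hcl, hEq⟩ := hvalid
    have h1 := hk.2
    rw [hμ k hk.1, hEq] at h1
    have := card_critSupport_toLinClause_le_one G c cl hcl
    omega
  · -- resolve i j f: subadditivity and minimality
    rename_i i j f _
    obtain ⟨hi, hj, C, D, hCi, hDj, hEq⟩ := hvalid
    rw [List.length_take] at hi hj
    have hik : i < k := lt_of_lt_of_le hi (min_le_left _ _)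
    have hjk : j < k := lt_of_lt_of_le hj (min_le_left _ _)
    have hil : i < π.length := lt_of_lt_of_le hi (min_le_right _ _)
    have hjl : j < π.length := lt_of_lt_of_le hj (min_le_right _ _)
    rw [List.getElem_take] at hCi hDj
    have hsub := critSupport_resolve G c f C D
    rw [← hEq, ← hCi, ← hDj] at hsub
    have hcard := (Finset.card_le_card hsub).trans (Finset.card_union_le _ _)
    have hmi := hmin i hik hil
    have hmj := hmin j hjk hjl
    rw [hμ i hil] at hmi
    rw [hμ j hjl] at hmj
    rw [hμ k hk.1]
    omega
  · -- weaken i: monotonicity and minimality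
    rename_i i _
    obtain ⟨hi, himp⟩ := hvalid
    rw [List.length_take] at hi
    have hik : i < k := lt_of_lt_of_le hi (min_le_left _ _)
    have hil : i < π.length := lt_of_lt_of_le hi (min_le_right _ _)
    have hsub := critSupport_weaken G c himp
    rw [List.getElem_take] at hsub
    have hcard := Finset.card_le_card hsub
    have hmi := hmin i hik hil
    rw [hμ i hil] at hmi
    rw [hμ k hk.1]
    omega

end TseitinLiftProofs

end Literature.Computability.MetaComplexity
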